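import Mathlib
import Summits.Parity.BatemanHorn.Theorems.SoloBlindAlignment
import Literature.NumberTheory.Sieve.IwaniecAlmostPrimesMertens
import Literature.NumberTheory.Sieve.IwaniecAlmostPrimesProp2Prep
import Literature.NumberTheory.Sieve.IwaniecAlmostPrimesProp1Corollary
import Literature.NumberTheory.LFunctions.MertensTail

/-!
# The `2x`-smooth part of `∏_{k ≤ x} (k² + 1)` is at most `x log x + O(x)` in logarithm

First half of the Chebyshev–Markov valuation count for `k² + 1` (completed in
`SoloBlindChebyshev.lean`).  For `k ≤ x` write `log (k²+1) = ∑_p v_p(k²+1) log p` and split the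
primes at `2x`: the primes `> 2x` are the `bigPrimes x k` of `SoloBlindAlignment.lean` (at most one
per `k`, each of logarithm `≤ log (x²+1)`), and the primes `p ≤ 2x` contribute in total

  `∑_{p ≤ 2x} log p ∑_{1 ≤ k ≤ x} v_p(k²+1) ≤ x R(2x) + 2 θ(2x) + 4x + 2 π(x) log (x²+1)`

(`smooth_part_le`), where `R(t) = ∑_{p ≤ t} ρ(p) log p / p` is the tree's `Iwaniec1978.rhoLogSum`
and `θ` is Chebyshev's function (Mathlib).  Inputs: the trivial estimate
`#{1 ≤ k ≤ x : d ∣ k²+1} ≤ ρ(d) x/d + ρ(d)` (`Iwaniec1978.abs_rem_le_rho`), `ρ(p), ρ(p^a) ≤ 2`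
(`rho_le_two`, `rho_primePow_le_two`), `∑_p log p/(p(p−1)) ≤ 2` (`MertensBound`), and the
identity `v_p(n) = #{a ≥ 1 : p^a ∣ n}`.  Classical (Chebyshev 1895, Markov 1895; Hooley, *Acta Math.*
**117** (1967) §2); recorded here as the size input for the aligned Type II form of paper §10.1.
-/

open Finset Real

namespace Summit.Parity.BatemanHorn.Theorems.SoloBlindSmoothPart

open Summit.Parity.BatemanHorn.Theorems.SoloBlindAlignment
open Literature.NumberTheory.Sieve.Iwaniec1978

/-! ### Logarithms and valuations -/

/-- `log n = ∑_{p ∣ n} v_p(n) log p`. -/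
theorem log_eq_sum_primeFactors (n : ℕ) :
    Real.log n = ∑ p ∈ n.primeFactors, (n.factorization p : ℝ) * Real.log p := by
  rw [Real.log_nat_eq_sum_factorization, Finsupp.sum, Nat.support_factorization]

/-- `v_p(n) log p ≤ log n` for `n ≠ 0`. -/
theorem factorization_mul_log_le {n p : ℕ} (hn : n ≠ 0) (hp : p.Prime) :
    (n.factorization p : ℝ) * Real.log p ≤ Real.log n := by
  rw [← Real.log_pow, ← Nat.cast_pow]
  exact Real.log_le_log (by exact_mod_cast pow_pos hp.pos _)
    (by exact_mod_cast Nat.le_of_dvd (Nat.pos_of_ne_zero hn) (Nat.ordProj_dvd n p))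

/-- The primes `> 2x` dividing `k² + 1` (`k ≤ x`) contribute at most `#bigPrimes · log (x²+1)`. -/
theorem sum_bigPrimes_le {x k : ℕ} (hk : k ≤ x) :
    ∑ p ∈ bigPrimes x k, ((k ^ 2 + 1).factorization p : ℝ) * Real.log p
      ≤ ((bigPrimes x k).card : ℝ) * Real.log ((x : ℝ) ^ 2 + 1) := by
  have h : ∀ p ∈ bigPrimes x k,
      ((k ^ 2 + 1).factorization p : ℝ) * Real.log p ≤ Real.log ((x : ℝ) ^ 2 + 1) := by
    intro p hp
    rw [mem_bigPrimes] at hp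
    calc ((k ^ 2 + 1).factorization p : ℝ) * Real.log p
        ≤ Real.log ((k ^ 2 + 1 : ℕ) : ℝ) := factorization_mul_log_le (by positivity) hp.1
      _ ≤ Real.log ((x : ℝ) ^ 2 + 1) := by
          apply Real.log_le_log (by positivity)
          have : (k : ℝ) ≤ x := by exact_mod_cast hk
          push_cast
          nlinarith
  calc ∑ p ∈ bigPrimes x k, ((k ^ 2 + 1).factorization p : ℝ) * Real.log p
      ≤ ∑ _p ∈ bigPrimes x k, Real.log ((x : ℝ) ^ 2 + 1) := Finset.sum_le_sum h
    _ = ((bigPrimes x k).card : ℝ) * Real.log ((x : ℝ) ^ 2 + 1) := by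
        rw [Finset.sum_const, nsmul_eq_mul]

/-- The primes `≤ 2x` dividing `k² + 1`: the sum may be taken over all primes `≤ 2x`. -/
theorem sum_smallPrimes_eq (x k : ℕ) :
    ∑ p ∈ (k ^ 2 + 1).primeFactors.filter (fun p : ℕ => ¬ 2 * x < p),
        (((k ^ 2 + 1).factorization p : ℕ) : ℝ) * Real.log ((p : ℕ) : ℝ)
      = ∑ p ∈ Nat.primesLE (2 * x), (((k ^ 2 + 1).factorization p : ℕ) : ℝ) * Real.log ((p : ℕ) : ℝ) := by
  apply Finset.sum_subset
  · intro p hp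
    rw [Finset.mem_filter, Nat.mem_primeFactors] at hp
    rw [Nat.mem_primesLE]
    exact ⟨by omega, hp.1.1⟩
  · intro p hp hnot
    rw [Nat.mem_primesLE] at hp
    have hndvd : ¬ p ∣ k ^ 2 + 1 := by
      intro hd
      apply hnot
      rw [Finset.mem_filter, Nat.mem_primeFactors]
      exact ⟨⟨hp.2, hd, by positivity⟩, by omega⟩
    simp [Nat.factorization_eq_zero_of_not_dvd hndvd]

/-- Per-`k` decomposition: `log (k²+1) ≤ #bigPrimes · log (x²+1) + ∑_{p ≤ 2x} v_p(k²+1) log p`. -/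
theorem log_sq_add_one_le {x k : ℕ} (hk : k ≤ x) :
    Real.log ((k : ℝ) ^ 2 + 1) ≤ ((bigPrimes x k).card : ℝ) * Real.log ((x : ℝ) ^ 2 + 1)
      + ∑ p ∈ Nat.primesLE (2 * x), ((k ^ 2 + 1).factorization p : ℝ) * Real.log p := by
  have h0 : Real.log ((k : ℝ) ^ 2 + 1) = Real.log ((k ^ 2 + 1 : ℕ) : ℝ) := by norm_cast
  rw [h0, log_eq_sum_primeFactors,
    ← Finset.sum_filter_add_sum_filter_not _ (fun p : ℕ => 2 * x < p)]
  have h1 : (k ^ 2 + 1).primeFactors.filter (fun p : ℕ => 2 * x < p) = bigPrimes x k := rfl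
  rw [h1, sum_smallPrimes_eq]
  exact add_le_add (sum_bigPrimes_le hk) le_rfl

/-! ### Counting: `∑_{k ≤ x} v_p(k²+1)` through `ρ` -/

/-- `v_p(n) = #{1 ≤ a ≤ A : p^a ∣ n}` when `n < p^{A+1}`. -/
theorem factorization_eq_card {p n A : ℕ} (hp : p.Prime) (hn : n ≠ 0) (hA : n < p ^ (A + 1)) :
    n.factorization p = ((Icc 1 A).filter (fun a => p ^ a ∣ n)).card := by
  have hv : n.factorization p ≤ A := by
    have hle : p ^ n.factorization p ≤ n :=
      Nat.le_of_dvd (Nat.pos_of_ne_zero hn) (Nat.ordProj_dvd n p)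
    by_contra h
    have h := Nat.lt_of_not_le h
    have : p ^ (A + 1) ≤ p ^ n.factorization p := Nat.pow_le_pow_right hp.pos h
    omega
  have hset : (Icc 1 A).filter (fun a => p ^ a ∣ n) = Icc 1 (n.factorization p) := by
    ext a
    simp only [Finset.mem_filter, Finset.mem_Icc, hp.pow_dvd_iff_le_factorization hn]
    omega
  rw [hset, Nat.card_Icc]
  omega

/-- `∑_{1 ≤ k ≤ x} v_p(k²+1) = ∑_{1 ≤ a ≤ A} #{1 ≤ k ≤ x : p^a ∣ k²+1}`, `A = ⌊log_p (x²+1)⌋`. -/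
theorem sum_factorization_eq {x p : ℕ} (hp : p.Prime) :
    ∑ k ∈ Icc 1 x, (k ^ 2 + 1).factorization p
      = ∑ a ∈ Icc 1 (Nat.log p (x ^ 2 + 1)), congrCount (x : ℝ) (p ^ a) := by
  set A := Nat.log p (x ^ 2 + 1) with hAdef
  have hk : ∀ k ∈ Icc 1 x, (k ^ 2 + 1).factorization p
      = ((Icc 1 A).filter (fun a => p ^ a ∣ k ^ 2 + 1)).card := by
    intro k hk
    rw [Finset.mem_Icc] at hk
    apply factorization_eq_card hp (by positivity)
    calc k ^ 2 + 1 ≤ x ^ 2 + 1 := Nat.add_le_add_right (Nat.pow_le_pow_left hk.2 2) 1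
      _ < p ^ (A + 1) := Nat.lt_pow_succ_log_self hp.one_lt _
  rw [Finset.sum_congr rfl hk]
  simp_rw [Finset.card_filter]
  rw [Finset.sum_comm]
  apply Finset.sum_congr rfl
  intro a _
  unfold congrCount
  rw [Nat.floor_natCast, Finset.card_filter]

/-- The trivial estimate `#{1 ≤ k ≤ x : d ∣ k²+1} ≤ ρ(d) x / d + ρ(d)`. -/
theorem congrCount_le (x : ℕ) {d : ℕ} (hd : d ≠ 0) :
    (congrCount (x : ℝ) d : ℝ) ≤ (rho d : ℝ) * x / d + rho d := by
  have h := abs_rem_le_rho (x := (x : ℝ)) (by positivity) hd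
  unfold rem at h
  have := (abs_le.mp h).2
  linarith

/-- The geometric tail `∑_{2 ≤ a ≤ A} p^{-a} ≤ 1/(p(p−1))`. -/
theorem sum_Icc_inv_pow_le {p : ℕ} (hp : 2 ≤ p) (A : ℕ) :
    ∑ a ∈ Icc 2 A, ((p : ℝ) ^ a)⁻¹ ≤ 1 / ((p : ℝ) * (p - 1)) := by
  have hp' : (2 : ℝ) ≤ p := by exact_mod_cast hp
  have hp1 : (0 : ℝ) < (p : ℝ) - 1 := by linarith
  have hp0 : (0 : ℝ) < p := by linarith
  have hp1' : (p : ℝ) - 1 ≠ 0 := ne_of_gt hp1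
  have hp0' : (p : ℝ) ≠ 0 := ne_of_gt hp0
  -- stronger telescoped statement for `A ≥ 1`
  have key : ∀ B : ℕ, 1 ≤ B →
      ∑ a ∈ Icc 2 B, ((p : ℝ) ^ a)⁻¹ ≤ 1 / ((p : ℝ) * (p - 1)) - 1 / (((p : ℝ) - 1) * p ^ B) := by
    intro B hB
    induction B, hB using Nat.le_induction with
    | base =>
        rw [show Icc 2 1 = (∅ : Finset ℕ) by decide, Finset.sum_empty, pow_one,
          mul_comm ((p : ℝ) - 1) (p : ℝ), sub_self]
    | succ m hm ih =>
        rw [Finset.sum_Icc_succ_top (by omega)]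
        have hpm : (0 : ℝ) < (p : ℝ) ^ m := pow_pos hp0 m
        have h1 : 1 / (((p : ℝ) - 1) * p ^ m) = ((p : ℝ) ^ (m + 1))⁻¹ + 1 / (((p : ℝ) - 1) * p ^ (m + 1)) := by
          field_simp
          ring
        linarith
  rcases Nat.lt_or_ge A 1 with hA | hA
  · rw [Finset.Icc_eq_empty (by omega)]
    simp only [Finset.sum_empty]
    exact div_nonneg zero_le_one (mul_nonneg hp0.le hp1.le)
  · have := key A hA
    have : 0 < 1 / (((p : ℝ) - 1) * p ^ A) := div_pos one_pos (mul_pos hp1 (pow_pos hp0 A))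
    linarith

/-- **The local count**: for a prime `p` and `x ≥ 1`,
`∑_{1 ≤ k ≤ x} v_p(k²+1) ≤ ρ(p) x / p + 2 + 2x/(p(p−1)) + 2 · [p² ≤ x²+1] · log_p(x²+1)`. -/
theorem sum_factorization_le {x p : ℕ} (hp : p.Prime) :
    (∑ k ∈ Icc 1 x, ((k ^ 2 + 1).factorization p : ℝ))
      ≤ (rho p : ℝ) * x / p + 2 + 2 * x / ((p : ℝ) * (p - 1))
        + 2 * (if p ^ 2 ≤ x ^ 2 + 1 then (Nat.log p (x ^ 2 + 1) : ℝ) else 0) := by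
  have hcast : (∑ k ∈ Icc 1 x, ((k ^ 2 + 1).factorization p : ℝ))
      = ∑ a ∈ Icc 1 (Nat.log p (x ^ 2 + 1)), (congrCount (x : ℝ) (p ^ a) : ℝ) := by
    have := sum_factorization_eq (x := x) hp
    exact_mod_cast congrArg (Nat.cast : ℕ → ℝ) this
  rw [hcast]
  set A := Nat.log p (x ^ 2 + 1) with hAdef
  have hp2 : 2 ≤ p := hp.two_le
  have hp0 : (0 : ℝ) < p := by exact_mod_cast hp.pos
  have hp1 : (0 : ℝ) < (p : ℝ) - 1 := by
    have : (2 : ℝ) ≤ p := by exact_mod_cast hp2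
    linarith
  have hρ : (rho p : ℝ) ≤ 2 := by exact_mod_cast rho_le_two hp
  have hρ0 : (0 : ℝ) ≤ rho p := by positivity
  have hind0 : (0 : ℝ) ≤ (if p ^ 2 ≤ x ^ 2 + 1 then (A : ℝ) else 0) := by
    split_ifs <;> positivity
  have hq0 : (0 : ℝ) ≤ 2 * x / ((p : ℝ) * (p - 1)) :=
    div_nonneg (by positivity) (mul_nonneg hp0.le hp1.le)
  have hr0 : (0 : ℝ) ≤ (rho p : ℝ) * x / p := by positivity
  rcases Nat.lt_or_ge A 1 with hA | hA
  · rw [Finset.Icc_eq_empty (by omega)]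
    simp only [Finset.sum_empty]
    linarith
  -- split off `a = 1`
  rw [← Finset.insert_Icc_add_one_left_eq_Icc hA, Finset.sum_insert (by simp),
    show Icc (1 + 1) A = Icc 2 A from rfl]
  have h1 : (congrCount (x : ℝ) (p ^ 1) : ℝ) ≤ (rho p : ℝ) * x / p + 2 := by
    have := congrCount_le x (d := p ^ 1) (by positivity)
    rw [pow_one] at this ⊢
    linarith
  -- the terms `a ≥ 2`
  have h2 : ∀ a ∈ Icc 2 A, (congrCount (x : ℝ) (p ^ a) : ℝ) ≤ 2 * x * ((p : ℝ) ^ a)⁻¹ + 2 := by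
    intro a ha
    rw [Finset.mem_Icc] at ha
    have hc := congrCount_le x (d := p ^ a) (by positivity)
    have hρa : (rho (p ^ a) : ℝ) ≤ 2 := by exact_mod_cast rho_primePow_le_two hp (by omega)
    have hρa0 : (0 : ℝ) ≤ rho (p ^ a) := by positivity
    have hpa : (0 : ℝ) < (p : ℝ) ^ a := pow_pos hp0 a
    have : (rho (p ^ a) : ℝ) * x / ((p ^ a : ℕ) : ℝ) ≤ 2 * x * ((p : ℝ) ^ a)⁻¹ := by
      calc (rho (p ^ a) : ℝ) * x / ((p ^ a : ℕ) : ℝ) = (rho (p ^ a) : ℝ) * x * ((p : ℝ) ^ a)⁻¹ := by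
            push_cast; ring
        _ ≤ 2 * x * ((p : ℝ) ^ a)⁻¹ := by gcongr
    linarith
  have h3 : ∑ a ∈ Icc 2 A, (congrCount (x : ℝ) (p ^ a) : ℝ)
      ≤ 2 * x * (1 / ((p : ℝ) * (p - 1))) + 2 * ((Icc 2 A).card : ℝ) := by
    calc ∑ a ∈ Icc 2 A, (congrCount (x : ℝ) (p ^ a) : ℝ)
        ≤ ∑ a ∈ Icc 2 A, (2 * x * ((p : ℝ) ^ a)⁻¹ + 2) := Finset.sum_le_sum h2
      _ = 2 * x * ∑ a ∈ Icc 2 A, ((p : ℝ) ^ a)⁻¹ + 2 * ((Icc 2 A).card : ℝ) := by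
          rw [Finset.sum_add_distrib, Finset.mul_sum, Finset.sum_const, nsmul_eq_mul]
          ring
      _ ≤ 2 * x * (1 / ((p : ℝ) * (p - 1))) + 2 * ((Icc 2 A).card : ℝ) := by
          have := sum_Icc_inv_pow_le hp2 A
          have hx0 : (0 : ℝ) ≤ 2 * x := by positivity
          nlinarith
  have h4 : ((Icc 2 A).card : ℝ) ≤ (if p ^ 2 ≤ x ^ 2 + 1 then (A : ℝ) else 0) := by
    rw [Nat.card_Icc]
    split_ifs with hcase
    · have : (↑(A + 1 - 2) : ℝ) ≤ A := by
        exact_mod_cast (by omega : A + 1 - 2 ≤ A)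
      exact this
    · -- `p² > x²+1` forces `A ≤ 1`
      have hA1 : A ≤ 1 := by
        by_contra h
        have h := Nat.succ_le_of_lt (Nat.lt_of_not_le h)
        apply hcase
        calc p ^ 2 ≤ p ^ A := Nat.pow_le_pow_right hp.pos h
          _ ≤ x ^ 2 + 1 := by
              rw [hAdef]
              exact Nat.pow_log_le_self p (by positivity)
      have : A + 1 - 2 = 0 := by omega
      rw [this]
      simp
  have h5 : 2 * x * (1 / ((p : ℝ) * (p - 1))) = 2 * x / ((p : ℝ) * (p - 1)) := by ring
  linarith [h1, h3, h4, h5]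

/-! ### Summing over the primes `p ≤ 2x` -/

/-- `A log p ≤ log (x²+1)` for `A = ⌊log_p (x²+1)⌋`, and the indicator restricts to `p ≤ x`. -/
theorem indicator_log_le {x p : ℕ} (hp : p.Prime) :
    (if p ^ 2 ≤ x ^ 2 + 1 then (Nat.log p (x ^ 2 + 1) : ℝ) else 0) * Real.log p
      ≤ (if p ≤ x then Real.log ((x : ℝ) ^ 2 + 1) else 0) := by
  split_ifs with h1 h2 h2
  · -- main case
    rw [← Real.log_pow, ← Nat.cast_pow]
    apply Real.log_le_log (by exact_mod_cast pow_pos hp.pos _)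
    have := Nat.pow_log_le_self p (x := x ^ 2 + 1) (by positivity)
    exact_mod_cast this
  · exfalso
    apply h2
    by_contra h
    have h := Nat.lt_of_not_le h
    have : (x + 1) ^ 2 ≤ p ^ 2 := Nat.pow_le_pow_left (by omega) 2
    nlinarith [hp.two_le]
  · simp only [zero_mul]
    exact Real.log_nonneg (by nlinarith [sq_nonneg (x : ℝ)])
  · simp

/-- The smooth part: `∑_{p ≤ 2x} log p ∑_{k ≤ x} v_p(k²+1) ≤ x R(2x) + 2 θ(2x) + 4x + 2 π(x) log(x²+1)`. -/
theorem smooth_part_le (x : ℕ) :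
    ∑ p ∈ Nat.primesLE (2 * x), Real.log p * ∑ k ∈ Icc 1 x, ((k ^ 2 + 1).factorization p : ℝ)
      ≤ (x : ℝ) * rhoLogSum ((2 * x : ℕ) : ℝ) + 2 * Chebyshev.theta ((2 * x : ℕ) : ℝ) + 4 * x
        + 2 * ((Nat.primesLE x).card : ℝ) * Real.log ((x : ℝ) ^ 2 + 1) := by
  have hterm : ∀ p ∈ Nat.primesLE (2 * x),
      Real.log p * ∑ k ∈ Icc 1 x, ((k ^ 2 + 1).factorization p : ℝ)
        ≤ (x : ℝ) * ((rho p : ℝ) * Real.log p / p) + 2 * Real.log p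
          + 2 * x * (Real.log p / ((p : ℝ) * (p - 1)))
          + 2 * (if p ≤ x then Real.log ((x : ℝ) ^ 2 + 1) else 0) := by
    intro p hp
    rw [Nat.mem_primesLE] at hp
    have hlog : 0 ≤ Real.log p := Real.log_nonneg (by exact_mod_cast hp.2.one_lt.le)
    have h := sum_factorization_le (x := x) hp.2
    have hi := indicator_log_le (x := x) hp.2
    have hp0 : (0 : ℝ) < p := by exact_mod_cast hp.2.pos
    have := mul_le_mul_of_nonneg_left h hlog
    have e1 : Real.log p * ((rho p : ℝ) * x / p + 2 + 2 * x / ((p : ℝ) * (p - 1))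
        + 2 * (if p ^ 2 ≤ x ^ 2 + 1 then (Nat.log p (x ^ 2 + 1) : ℝ) else 0))
        = (x : ℝ) * ((rho p : ℝ) * Real.log p / p) + 2 * Real.log p
          + 2 * x * (Real.log p / ((p : ℝ) * (p - 1)))
          + 2 * ((if p ^ 2 ≤ x ^ 2 + 1 then (Nat.log p (x ^ 2 + 1) : ℝ) else 0) * Real.log p) := by
      ring
    linarith
  calc ∑ p ∈ Nat.primesLE (2 * x), Real.log p * ∑ k ∈ Icc 1 x, ((k ^ 2 + 1).factorization p : ℝ)
      ≤ ∑ p ∈ Nat.primesLE (2 * x), ((x : ℝ) * ((rho p : ℝ) * Real.log p / p) + 2 * Real.log p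
          + 2 * x * (Real.log p / ((p : ℝ) * (p - 1)))
          + 2 * (if p ≤ x then Real.log ((x : ℝ) ^ 2 + 1) else 0)) := Finset.sum_le_sum hterm
    _ = (x : ℝ) * rhoLogSum ((2 * x : ℕ) : ℝ) + 2 * Chebyshev.theta ((2 * x : ℕ) : ℝ)
          + 2 * x * ∑ p ∈ Nat.primesLE (2 * x), Real.log p / ((p : ℝ) * (p - 1))
          + 2 * ∑ p ∈ Nat.primesLE (2 * x), (if p ≤ x then Real.log ((x : ℝ) ^ 2 + 1) else 0) := by
        rw [rhoLogSum, Nat.floor_natCast, Chebyshev.theta_eq_sum_primesLE_log,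
          Finset.sum_add_distrib, Finset.sum_add_distrib, Finset.sum_add_distrib,
          Finset.mul_sum, Finset.mul_sum, Finset.mul_sum, Finset.mul_sum]
    _ ≤ (x : ℝ) * rhoLogSum ((2 * x : ℕ) : ℝ) + 2 * Chebyshev.theta ((2 * x : ℕ) : ℝ) + 4 * x
          + 2 * ((Nat.primesLE x).card : ℝ) * Real.log ((x : ℝ) ^ 2 + 1) := by
        have hA := Literature.NumberTheory.LFunctions.MertensBound.sum_log_div_mul_pred_le_two (2 * x)
        have hB : ∑ p ∈ Nat.primesLE (2 * x), (if p ≤ x then Real.log ((x : ℝ) ^ 2 + 1) else 0)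
            = ((Nat.primesLE x).card : ℝ) * Real.log ((x : ℝ) ^ 2 + 1) := by
          rw [← Finset.sum_filter]
          have hs : (Nat.primesLE (2 * x)).filter (fun p => p ≤ x) = Nat.primesLE x := by
            ext p
            simp only [Finset.mem_filter, Nat.mem_primesLE]
            constructor
            · rintro ⟨⟨_, hp⟩, hle⟩; exact ⟨hle, hp⟩
            · rintro ⟨hle, hp⟩; exact ⟨⟨by omega, hp⟩, hle⟩
          rw [hs, Finset.sum_const, nsmul_eq_mul]
        rw [hB]
        have hx0 : (0 : ℝ) ≤ 2 * x := by positivity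
        nlinarith

end Summit.Parity.BatemanHorn.Theorems.SoloBlindSmoothPart
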